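import Summits.HodgeConjecture.HodgeConjecture.Theorems.VHCAbelianSchemesRoadSecondCarriedHGoodTypingDefs
import Literature.AlgebraicGeometry.HodgeTheory.TwistedReflexiveClassOfSchemeIso
import Literature.AlgebraicGeometry.HodgeTheory.AbelianVarietyPullbackAlgebraicClasses
import Literature.AlgebraicGeometry.HodgeTheory.HodgeClassesIsogenyInvariance
import HarnessLib

/-!
# Road №4 (`VHCAbelianSchemesRoad`) — THE MOVED DATUM «`(ḡ_u)_*𝓔̄` IS an `Adm`-twisted datum» FROM THEOREM T AND GRR
# (`IsogenyMovesPinnedTwistedData C Adm` of p618714, kernel-checked from its two displayed inputs; helper toward child (c3)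
# `stub_secondCarriedOfOffDiagonalVanishingPrime_of_T_GRR` of crux stmt-HodgeConjecture-26512, skeleton v3.9 f1912d6f699b48a2)

research route conditional on HC_CM; not a corollary; Q11.4-sentence-2 already refuted in dim ≥ 3.

THEOREMS ONLY (ring2-b03x gen 14; fact-free, no definition, `HC_CM` nowhere; `--supports stmt-HodgeConjecture-26512`). p618714
(`…SecondCarriedHGoodTypingDefs`, §4) typed the joint object-level consequence of THEOREM T (`IsogenyPushforwardAdmissibilityTransfer Adm`:
`g_*E•` is a bounded complex of vector bundles and `Adm (g_*E•) ↔ Adm E•`, given (C^∨)) and GRR (`IsogenyPushforwardChernCharacter C`: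
`g^*ch_k(g_*E•) = #Ker g(ℂ)·ch_k(E•)`) as the `Prop`-node `IsogenyMovesPinnedTwistedData C Adm`: on an abelian sixfold, for an isogeny `g`
with `g^*θ = N·θ`, a pinned twisted datum `𝓓` of `(θ, γ)` with (C^∨) for `(g, 𝓓.E)`, and `γ'` with `g^*γ' = #Ker g·γ`, there is a pinned
twisted datum of `(θ, γ')` WHOSE OBJECT IS `g_*𝓓.E` (same degree set `I`). Its docstring says «implied on paper by T ∧ GRR»; THIS FILE
PROVES THAT IMPLICATION (`isogenyMovesPinnedTwistedData_of_transfer_of_chernCharacter`):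

* the `B`-field: `B₀' := N₀⁻²·h^*B₀` for a quasi-inverse `h` of `g` (`g ≫ h = [N₀]`, Mumford §19), so `g^*B₀' = B₀`; it is RATIONAL
  (`IsRationalClass.map`, rational scalar) and ALGEBRAIC (pull-back of an algebraic class to an abelian variety is algebraic,
  `map_mem_algebraicClasses_of_abelianVariety`; `algebraicClasses` is a `ℂ`-subspace) — `exists_rational_algebraic_preimage_of_isIsogeny`;
* the pins: `g^*` is injective on `H^{2k}` (`complexBetti_map_bijective_of_isIsogeny`), commutes with the `B`-twist (`map_expTwistClasses`),
  GRR makes `g^*ch(g_*E•) = #Ker g·ch(E•)` and the twist is linear in the family (`expTwistClasses_smul_family`), so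
  `g^*κ(g_*E•, B₀') = #Ker g·κ(E•, B₀)`; with `g^*θᵏ = Nᵏ·θᵏ` the scalars `c'_k := #Ker g·c_k·N⁻ᵏ` do it (`N = 0` forces `θ = 0`, handled);
* the admissibility and boundedness of `g_*𝓓.E`: THEOREM T verbatim (`A.dim = 6`).

So the moved datum is no longer an independent node: (c3) consumes T′ ∧ GRR through this theorem. Nothing here says T, GRR, (C^∨), any stub,
2m′ᵒᴴ, 26512, `HC_AV` or HC holds. References: [cite: Markman2025SecantWeil, §1.3, Cor. 1.3.2, Cor. 4.0.4 and Lemma 9.3.6]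
[cite: Fulton1998, §15.1–15.2 and §19.2 Cor. 19.2 (b)] [cite: MumfordAV1970, §19 Remark p. 169] [cite: vanGeemen1994HodgeAV, §3.6 (p. 236)]
[cite: HuybrechtsStellari2005, §1] [cite: Perry2026Semiregularity, Thm. 1.1] [cite: HatcherAT2002, §3.2 and Prop. 3.10].
-/

noncomputable section

open CategoryTheory CategoryTheory.Limits AlgebraicGeometry Topology

namespace Summit.HodgeConjecture.HodgeConjecture.Ring2.SemiregularRepresentatives

set_option linter.dupNamespace false -- the cell's namespace repeats the summit name, as in every `Ring2*` file

open Literature.AlgebraicGeometry Literature.AlgebraicGeometry.Motives Literature.AlgebraicGeometry.Motives.AbelianVariety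
open Literature.AlgebraicGeometry.HodgeTheory Literature.AlgebraicGeometry.Markman2025
open Literature.AlgebraicTopology.SingularHomology

/-! ## §1 Preimages under the pull-back of an isogeny keep rationality and algebraicity -/

section Preimage

variable {A B : AbelianVariety ℂ}

/-- **A rational class has a RATIONAL preimage under `g^*` for an isogeny `g : A ⟶ B`**: with a quasi-inverse `h`, `g ≫ h = [N₀]`
(Mumford §19), `y := N₀⁻ᵏ·h^*x` has `g^*y = N₀⁻ᵏ·[N₀]^*x = x` (`[N₀]^* = N₀ᵏ` on `Hᵏ`) and is rational.
[cite: MumfordAV1970, §19 Remark p. 169 and §1 (3)] [cite: vanGeemen1994HodgeAV, §3.6 (p. 236)] -/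
theorem exists_rational_preimage_of_isIsogeny {g : A ⟶ B} (hg : IsIsogeny g) {k : ℕ} {x : complexBetti A.X k}
    (hx : IsRationalClass x) :
    ∃ y : complexBetti B.X k, IsRationalClass y ∧ complexBetti.map g.hom.hom.hom k y = x := by
  obtain ⟨h, N₀, hN₀, hgh, -⟩ := AbelianVariety.IsIsogeny.exists_nsmul_inverse_holds hg
  have hN' : ((N₀ : ℂ) ^ k) ≠ 0 := pow_ne_zero _ (Nat.cast_ne_zero.mpr hN₀.ne')
  set q : ℚ := (((N₀ ^ k : ℕ) : ℚ))⁻¹ with hq_def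
  have hq : (q : ℂ) * (N₀ : ℂ) ^ k = 1 := by
    rw [hq_def]; push_cast; exact inv_mul_cancel₀ hN'
  refine ⟨(q : ℂ) • complexBetti.map h.hom.hom.hom k x, (hx.map _).smul q, ?_⟩
  rw [map_smul, complexBetti_map_map_of_comp_eq_nsmul_id hgh, smul_smul, hq, one_smul]

/-- **A rational ALGEBRAIC class has a rational algebraic preimage under `g^*` for an isogeny `g : A ⟶ B`**: the same `y = N₀⁻²ᵖ·h^*x`;
`h^*x` is algebraic because pull-back of an algebraic class to an abelian variety is algebraic (Fulton Cor. 19.2 (b) on an abelian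
target, the tree's `map_mem_algebraicClasses_of_abelianVariety`), and `algebraicClasses` is a `ℂ`-subspace.
[cite: Fulton1998, §19.2 Cor. 19.2 (b)] [cite: MumfordAV1970, §19 Remark p. 169] -/
theorem exists_rational_algebraic_preimage_of_isIsogeny {g : A ⟶ B} (hg : IsIsogeny g) {p : ℕ} {x : complexBetti A.X (2 * p)}
    (hx : IsRationalClass x) (hxa : x ∈ algebraicClasses A.X p) :
    ∃ y : complexBetti B.X (2 * p), IsRationalClass y ∧ y ∈ algebraicClasses B.X p ∧ complexBetti.map g.hom.hom.hom (2 * p) y = x := by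
  obtain ⟨h, N₀, hN₀, hgh, -⟩ := AbelianVariety.IsIsogeny.exists_nsmul_inverse_holds hg
  have hB : IsSmoothProjective B.dim B.X := AbelianVariety.isSmoothProjective_holds
  have hN' : ((N₀ : ℂ) ^ (2 * p)) ≠ 0 := pow_ne_zero _ (Nat.cast_ne_zero.mpr hN₀.ne')
  set q : ℚ := (((N₀ ^ (2 * p) : ℕ) : ℚ))⁻¹ with hq_def
  have hq : (q : ℂ) * (N₀ : ℂ) ^ (2 * p) = 1 := by
    rw [hq_def]; push_cast; exact inv_mul_cancel₀ hN'
  refine ⟨(q : ℂ) • complexBetti.map h.hom.hom.hom (2 * p) x, (hx.map _).smul q,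
    Submodule.smul_mem _ _ (map_mem_algebraicClasses_of_abelianVariety hB A h.hom.hom.hom hxa), ?_⟩
  rw [map_smul, complexBetti_map_map_of_comp_eq_nsmul_id hgh, smul_smul, hq, one_smul]

end Preimage

/-! ## §2 Bookkeeping: the `B`-twist is linear in the family; scalars along `g^*θᵏ = Nᵏ·θᵏ` -/

section Twist

variable (X : SchemeOver ℂ)

/-- **The `B`-twist is `ℂ`-linear in the family**: `(exp(B) ∪ (a·κ))_k = a·(exp(B) ∪ κ)_k` (each cup product is linear in its second
factor). [cite: HuybrechtsStellari2005, §1] [cite: HatcherAT2002, §3.2] -/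
theorem expTwistClasses_smul_family (B : complexBetti X 2) (κ : (j : ℕ) → complexBetti X (2 * j)) (a : ℂ) (k : ℕ) :
    expTwistClasses X B (fun j => a • κ j) k = a • expTwistClasses X B κ k := by
  unfold expTwistClasses
  rw [Finset.smul_sum]
  refine Finset.sum_congr rfl fun i _ => ?_
  rw [map_smul, smul_comm]

variable {X}

/-- **Scalar bookkeeping along `g^*θ = N·θ`** with `g^*` injective on `H²`: `(a·N⁻ᵏ·Nᵏ)·θᵏ = a·θᵏ` — trivial for `N ≠ 0`, and for
`N = 0` injectivity forces `θ = 0`, so `θᵏ = 0ᵏ = 0` for `k ≥ 1` (while `N⁰ = 1`). This is why the moved datum's scalars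
`c'_k = #Ker g·c_k·N⁻ᵏ` need no case distinction. [cite: HatcherAT2002, §3.2] -/
theorem smul_cupPowTwo_inv_pow_mul_pow (g : X ⟶ X) (hinj : Function.Injective (complexBetti.map g 2)) {θ : complexBetti X 2}
    {N : ℂ} (hθ : complexBetti.map g 2 θ = N • θ) (a : ℂ) (k : ℕ) :
    (a * (N⁻¹) ^ k * N ^ k) • cupPowTwo θ k = a • cupPowTwo θ k := by
  by_cases hN : N = 0
  · rcases Nat.eq_zero_or_pos k with rfl | hk
    · rw [pow_zero, pow_zero, mul_one, mul_one]
    · have hθ0 : θ = 0 := hinj (by rw [hθ, hN, zero_smul, map_zero])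
      -- `0ᵏ = 0` for `k ≥ 1` (the landed `cupPowTwo_zero_eq_zero_of_pos` lives outside this import cone)
      obtain ⟨j, rfl⟩ := Nat.exists_eq_add_of_le' hk
      rw [hθ0, cupPowTwo_succ, map_zero, smul_zero, smul_zero]
  · rw [mul_assoc, ← mul_pow, inv_mul_cancel₀ hN, one_pow, mul_one]

end Twist

/-! ## §3 The moved datum from THEOREM T and GRR -/

/-- **`IsogenyMovesPinnedTwistedData C Adm` FROM THEOREM T AND GRR** (p618714's node «`(ḡ_u)_*𝓔̄`, with `B₀' = (g^*)⁻¹B₀`, IS an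
`Adm`-twisted datum pinned to `(θ, γ')`, `g^*γ' = #Ker g·γ`», now a theorem of its two displayed inputs): given
`IsogenyPushforwardAdmissibilityTransfer Adm` (T) and `IsogenyPushforwardChernCharacter C` (GRR), on an abelian sixfold `A`, for an isogeny
`g` with `g^*θ = N·θ`, a datum `𝓓 : PinnedTwistedDatum C Adm A.X θ γ` with (C^∨) for `(g, 𝓓.E)` and every `γ'` with `g^*γ' = #Ker g(ℂ)·γ`,
the structure `⟨g_*𝓓.E, T-boundedness, B₀', T-admissibility, 𝓓.I, c'⟩` with `B₀' = N₀⁻²·h^*𝓓.B₀` (§1) and `c'_k = #Ker g·c_k·N⁻ᵏ` is a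
`PinnedTwistedDatum C Adm A.X θ γ'`: the pin identities hold after `g^*` (GRR, `map_expTwistClasses`, `g^*θᵏ = Nᵏθᵏ`) and `g^*` is
injective. [cite: Markman2025SecantWeil, §1.3 (η(k)^*h = Nm(k)h), Cor. 1.3.2, Cor. 4.0.4 and Lemma 9.3.6] [cite: Fulton1998, §15.2]
[cite: MumfordAV1970, §19 Remark p. 169] [cite: Perry2026Semiregularity, Thm. 1.1] -/
theorem isogenyMovesPinnedTwistedData_of_transfer_of_chernCharacter {C : ChernCharacterBetti} {Adm : PerfectAdmissibility}
    (hT : IsogenyPushforwardAdmissibilityTransfer Adm) (hG : IsogenyPushforwardChernCharacter C) :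
    IsogenyMovesPinnedTwistedData C Adm := by
  intro A hA g hg θ N hθ γ 𝓓 hC γ' hγ'
  obtain ⟨hbdd, hadm⟩ := hT A g hg 𝓓.E 𝓓.bounded hC
  set n : ℂ := (Nat.card (Hom.kerPoints (specOver ℂ ℂ) g) : ℂ) with hn
  obtain ⟨B₀', hB₀'Q, hB₀'alg, hgB₀'⟩ := exists_rational_algebraic_preimage_of_isIsogeny hg 𝓓.B₀_rational 𝓓.B₀_algebraic
  -- GRR on the Chern character family of `g_*𝓓.E`
  have hch : (fun j => complexBetti.map g.hom.hom.hom (2 * j)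
        (chPerfect C A.X (endoPushforwardComplex A g 𝓓.E) hbdd.isFiniteLocallyFree j)) =
      fun j => n • chPerfect C A.X 𝓓.E 𝓓.bounded.isFiniteLocallyFree j := by
    funext j
    exact hG A g hg 𝓓.E 𝓓.bounded hbdd j
  have hinj2 : Function.Injective (complexBetti.map g.hom.hom.hom 2) := (complexBetti_map_bijective_of_isIsogeny hg 2).1
  -- admissibility transfers by THEOREM T (`A.dim = 6`)
  have hadm6 : Adm 6 A.X 𝓓.I (endoPushforwardComplex A g 𝓓.E) := by
    have h := hadm 𝓓.I
    rw [hA] at h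
    exact h.2 𝓓.adm
  refine ⟨⟨endoPushforwardComplex A g 𝓓.E, hbdd, B₀', hB₀'Q, hB₀'alg, 𝓓.I, 𝓓.three_mem, hadm6, fun k => n * 𝓓.c k * (N⁻¹) ^ k,
    ?_, fun k hk hk3 => ?_⟩, rfl, rfl⟩
  · -- `κ'_3 = γ' + c'_3·θ³`, checked after `g^*`
    apply (complexBetti_map_bijective_of_isIsogeny hg (2 * 3)).1
    rw [map_expTwistClasses, hgB₀', hch, expTwistClasses_smul_family, 𝓓.kappa_three, map_add, map_smul, hγ',
      complexBetti_map_cupPowTwo_of_map_eq_smul g.hom.hom.hom hθ 3, smul_add, smul_smul, smul_smul,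
      smul_cupPowTwo_inv_pow_mul_pow g.hom.hom.hom hinj2 hθ (n * 𝓓.c 3) 3]
  · -- `κ'_k = c'_k·θᵏ`, `k ∈ I ∖ {3}`, checked after `g^*`
    apply (complexBetti_map_bijective_of_isIsogeny hg (2 * k)).1
    rw [map_expTwistClasses, hgB₀', hch, expTwistClasses_smul_family, 𝓓.kappa_of_ne k hk hk3, map_smul,
      complexBetti_map_cupPowTwo_of_map_eq_smul g.hom.hom.hom hθ k, smul_smul, smul_smul,
      smul_cupPowTwo_inv_pow_mul_pow g.hom.hom.hom hinj2 hθ (n * 𝓓.c k) k]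

/-- **The PRIMED instance**: `IsogenyMovesPinnedTwistedData C AdmTw′` from THEOREM T at the primed door
(`IsogenyPushforwardAdmissibilityTransferPrime`, child (c1)) and GRR (child (c2)) — the first internal step of child (c3).
[cite: Markman2025SecantWeil, Cor. 1.3.2, Cor. 4.0.4 and Lemma 9.3.6] [cite: BuchweitzFlenner2003, §5 Thm. 5.1] -/
theorem isogenyMovesPinnedTwistedData_prime_of_transfer_of_chernCharacter {C : ChernCharacterBetti}
    (hT : IsogenyPushforwardAdmissibilityTransferPrime) (hG : IsogenyPushforwardChernCharacter C) :
    IsogenyMovesPinnedTwistedData C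
      (fun n X₀ I E => Summit.Ventures.HSemireg.gluableSigmaAdmissible n X₀ I E ∨
        Literature.AlgebraicGeometry.HodgeTheory.bfSingleAdmissible' n X₀ I E) :=
  isogenyMovesPinnedTwistedData_of_transfer_of_chernCharacter hT hG

#print axioms isogenyMovesPinnedTwistedData_of_transfer_of_chernCharacter

end Summit.HodgeConjecture.HodgeConjecture.Ring2.SemiregularRepresentatives

end
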